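import Mathlib
import HarnessLib
import HarnessLib.Audit
import Summits.HodgeConjecture.Statement
import Literature.AlgebraicGeometry.HodgeTheory.MotivatedClasses
import Literature.AlgebraicGeometry.HodgeTheory.MiddleDimensionReduction
import Literature.AlgebraicGeometry.HodgeTheory.LefschetzOneOne
import Literature.AlgebraicGeometry.HodgeTheory.HodgeModelExistence
import HarnessLib.Audit.Status.Attr

/-!
Route: MotivatedLefschetzSplit

# Route MotivatedLefschetzSplit — HC split along André's chain — Hodge classes motivated (deep
middle) + standard conjecture B, glue proved

Lens `decomposition-first` applied to the summit-strength leaf X = the Statement itself (both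
B-ceiling leaves of this summit,
PadicSemiregularLift.HodgeBeyondAnchors and NikulinTwinTransport.SectorComplement, are
kernel-checked EQUIVALENT to `HodgeConjecture`).
It suffices to show X = HM ∧ B: (HM = HodgeClassesMotivated) on every smooth projective complex
n-fold, every rational class of Hodge
type (p,p) in the DEEP MIDDLE 2 ≤ p ≤ n/2 lies in André's space of MOTIVATED classes A_motᵖ(X)_ℂ
(span of pr_{X*}(α ∪ ⋆_L β), α, β
algebraic on X × Y, ⋆_L the Lefschetz involution of a polarisation of X × Y); and (B =
LefschetzStandardB) Grothendieck's standard
conjecture of Lefschetz type for every smooth projective complex variety, in André's form "⋆_L is an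
algebraic correspondence".
The typed split `closes : HM → B → Δ → (B → Δ → A_mot ⊆ A) → (BFNP Lemma 48 ∧ Hodge models) →
Lefschetz (1,1) → HodgeConjecture`
is PROVED (rev 1, Sketch.lean rc 0, 0 sorries, axioms {propext, Classical.choice, Quot.sound});
besides the two cruxes every hypothesis is
a routine SUPPORT: Δ (diagonal pull-back preserves the coniveau, Voisin II Prop. 9.21 (i),
difficulty L) and three provable-now items
(André's §2.1 step from tree lemmas; two DISCHARGED named facts) — filed as items so that the route
file rests on statement-level
Literature modules only (cone repair 2026-08-17: module cone 1534 → 51, unproved named facts in it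
116 → 4, none load-bearing).
Cards realised: dynkin-menu-intermediate-groups (spine: the HM ∧ B split and the Mumford–Tate vs
motivated-Galois attack on HM),
motivated-anchor-transport (HM's anchor line), lefschetz-b-abelian-pencils-localisation (B's
abelian-pencil structure),
hodge-endomorphism-census-pg2-surfaces (HM's first open instances as kill tests).
Lean: `HodgeClassesMotivated ∧ LefschetzStandardB`

## Assembly
`closes : HodgeClassesMotivated → LefschetzStandardB → DiagonalPullbackAlgebraic →
MotivatedSubAlgebraic → MiddleDimensionAndModels →
LefschetzOneOneRational → HodgeConjecture`, kernel-checked (rev 1; Sketch.lean / glue.lean):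
(i) reduce to rational (m,m)-classes on 2m-folds by BFNP Lemma 48 `middleDimensionReduction` with
Hodge models `nonempty_hodgeModel`
(support MiddleDimensionAndModels = the two named facts, both DISCHARGED in the tree:
`middleDimensionReduction_holds`,
`nonempty_hodgeModel_holds`; plugged in through `hodgeConjectureFor_of_middleDimension`); (ii) m =
0: N⁰H⁰ = H⁰ (`algebraicClasses_zero`);
m = 1: Lefschetz (1,1) (support LefschetzOneOneRational = the named fact `lefschetzOneOne_rational`,
DISCHARGED by
`lefschetzOneOne_rational_holds`); (iii) m ≥ 2: the class is in the deep middle, HM makes it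
motivated, and André's "B ⇒ A_mot ⊆ A"
(§2.1 "il est clair"; support MotivatedSubAlgebraic: ⋆_L β = γ^*β algebraic by B, α ∪ ⋆_L β
algebraic by the multiplicativity obtained
from Δ, pr_{X*} of it algebraic by the proved Gysin/support lemma — proved in the planner folder
from `MotivatedClassesProofs`, candidate
proof attached to the item) makes it algebraic. The three discharged/provable supports are consumed
as ITEMS (closed by one-line Theorems
files that carry the heavy discharge modules) rather than imported, because those modules'
transitive closures hold 116 unrelated
unproved named facts (four-manifold topology, resolution of singularities, GAGA) that would block
the route's staffing.

Rationale: WHY THIS LINE. André (Andre1996Motifs §0.3, Déf. 1, p. 14) built the ℚ-algebra of motivated cycles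
so that it "se réduit à celle de cycle algébrique
si … l'involution ⋆_L est donnée par une correspondance algébrique", proved that motivated-ness
DEFORMS unconditionally (Thm 0.5, the
motivic theorem of the fixed part) and that Hodge classes on abelian varieties, K3 surfaces and
cubic hypersurfaces are motivated
(Thm 0.6.2, 0.6.3, 7.1) — so the Hodge conjecture is the conjunction of two strictly weaker
statements with DISJOINT toolkits: HM
(recognition: variation of Hodge structure, Mumford–Tate vs the reductive motivated Galois group,
CDK algebraicity of Hodge loci and its
motivic analogue arXiv:2603.22171, Andre2006 specialisation) and B (construction of ONE
absolute-Hodge class per variety: Lieberman1968,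
Kleiman1968AlgebraicCycles, Arapura2006, Tankeev2011, Charles2013 spread criterion,
CharlesMarkman2013, Voisin2022, arXiv:2304.00978).
Imported area: the theory of pure motives / Tannakian categories (André's unconditional motivated
category, Thm 0.4) into a summit whose
28 open routes all attack cycle construction or Hodge-locus geography directly. What no prior route
does: PeriodsPolice has the two
inclusions Hdg ⊆ A_mot ⊆ A only over ℚ̄ and buys the first from the Grothendieck period conjecture;
ConservativityLefschetz (DONE) and
card lefschetz-b-abelian-pencils-localisation are the abelian SECTOR of B; AnchorTransport pays the
open variational Hodge conjecture
for transport that is FREE for motivated classes; the crux-strategist line andre-motivated-split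
(2026-08-17, crux HodgeBeyondAnchors of
PadicSemiregularLift) is this split one layer down — this route promotes it to summit level with
verbatim-identical child signatures
(one staffing), a glue that imports no other route, and birth skeletons giving each half its own
first lemma.

RANKED CRUXES. #2 HodgeClassesMotivated (crux) — (HM, deep-middle form; verbatim the strategist's
child on stmt-HodgeConjecture-14054) for X smooth projective of dimension n over ℂ, 2 ≤ p, 2p ≤ n,
every rational class of Hodge type (p,p) in H²ᵖ(X(ℂ);ℂ) lies in `motivatedClasses n X p` (André Déf.
1 on the real carriers). Implied by HC (algebraic ⊆ motivated, tree theorem); a THEOREM for abelian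
varieties (Thm 0.6.2), abelian-motivated varieties (K3, cubics ≤ dim 5, Fermat, products),
monodromy-generic members (Thm 0.6.4 + Weyl); first open instances: Hodge endomorphisms of H²_tr(S)
for surfaces S with p_g ≥ 2 (classes on S × S), exceptional (2,2)-classes at 0-dimensional
Noether–Lefschetz components in ℙ⁵. [difficulty: open-problem] (why it might fail: a Hodge class
that is not absolute Hodge (Deligne's conjecture false: e.g. an RM/CM endomorphism of H²_tr of a p_g
≥ 2 general-type surface moving under Aut(ℂ)) kills HM and HC at once; no lever off abelian type
beyond Thm 0.5/0.6.4.) [Andre1996Motifs, Andre2006, Arapura2006, CharlesSchnell2014Notes,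
arXiv:2603.22171, arXiv:1702.05430]
#3 LefschetzStandardB (crux) — (B; verbatim the strategist's child) Grothendieck's standard
conjecture of Lefschetz type for EVERY smooth projective complex Z, André's form: for every
polarisation class η of Z (rational, divisor-supported, hard Lefschetz) and all degrees a + b = 2
dim Z, the Lefschetz involution ⋆_L : Hᵃ(Z(ℂ)) → Hᵇ(Z(ℂ)) is induced by an algebraic class on Z × Z
(`StandardConjectureBStar`). One canonical absolute-Hodge class per variety; implied by HC(Z × Z) in
print; known for curves, surfaces, abelian varieties (Lieberman1968), flag varieties, complete
intersections, uniruled 3-folds / unirational 4-folds / S^[n] (Arapura2006), 3-folds with κ < 3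
(Tankeev2011), hyperkähler of K3^[n] type (CharlesMarkman2013), Lagrangian-covered / fibred HK
(Voisin2022, arXiv:2304.00978), generalised Kummer type (arXiv:2303.14327); stable under products
and for all polarisations at once (Andre1996Motifs §3.2 Remarque). [difficulty: open-problem] (why
it might fail: false iff some inverse Lefschetz map is non-algebraic — first suspects: threefolds of
general type with h^{2,0} ≠ 0 (degree-2 case, Charles2013 Thm 1 needs a codim-2 family whose
infinitesimal invariant fills H^{0,2}) and very general Weil-type abelian-pencil total spaces.)
[Kleiman1968AlgebraicCycles, Lieberman1968, Charles2013, CharlesMarkman2013, Arapura2006,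
Tankeev2011, Voisin2022, Voisin2025, arXiv:2304.00978]
#9 DiagonalPullbackAlgebraic (support) — (Δ; verbatim the strategist's support child) for V smooth
projective complex and c ∈ Nᵖ H²ᵖ((V × V)(ℂ); ℂ), the pull-back Δ^* c along the diagonal lies in Nᵖ
H²ᵖ(V(ℂ); ℂ) — Voisin II Prop. 9.21 (i) with Chow's moving lemma (Lemma 9.22) and Fulton §19.1
purity; the single input the tree isolates for "B ⇒ A_mot ⊆ A"
(`motivatedClasses_le_algebraicClasses_of_standardConjectureB_of_map_diagonal`, proved); it yields
the multiplicativity of algebraic classes (`cupProduct_mem_algebraicClasses_of_forall_map_diagonal`,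
proved). [difficulty: L] [VoisinHodgeII2003, Andre1996Motifs]

TWO-LAYER PLAN. Foreseen glued splits / lines once staffed (nothing filed now; birth skeletons in
the planner folder bc/, published as Lines/birth.lean after open):
HM ⇐ MotivatedAnchors → Andre1996_deformation (Thm 0.5, theorem; tree
`Andre1996_deformation_of_published_inputs`) → HM (kernel-checked
in bc/HodgeClassesMotivated_birth.lean): the transport half is FREE, only anchor geography remains;
HM ⇐ (π₀) G_mot(X) connected ∧ (Lie)
MT(X) = G_mot(X)⁰ (card dynkin-menu-intermediate-groups; needs a real-carrier motivated Galois group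
— definition request below);
B ⇐ LefschetzLowerHalf (a ≤ d: ⋆_L = L^{d−a}, theorem-grade) → FamilySupply (Charles2013 Prop. 8
spread form) → (FamilySupply →
LefschetzUpperHalf) (Charles's criterion, theorem in print) → B (kernel-checked in
bc/LefschetzStandardB_birth.lean); B ⟺ D (hom = num)
over ℂ (Kleiman) as a transfer option towards Kimura–O'Sullivan finite-dimensionality.

KILL CRITERIA. A non-motivated Hodge class — in particular any Hodge class that is not ABSOLUTE
Hodge (motivated ⇒ absolute Hodge) — refutes HodgeClassesMotivated
and closes the route `refuted:HodgeClassesMotivated` (and refutes HC). A non-algebraic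
inverse-Lefschetz class on any Z (equivalently, by the
barrier MotivatedClassesAbelianVarieties, any HC counterexample on an abelian variety) refutes
LefschetzStandardB and closes the route
`refuted:LefschetzStandardB`. HC proved elsewhere moots it; HM proved alone turns the route into the
conditional bridge HC ⟸ B (André §0.3);
B proved alone makes HC ⟺ HM (motivated = algebraic unconditionally).

NOT DECOMPOSED YET. The anchor-geography content of HM (which Hodge-locus components carry a
motivated/abelian-type point), the Mumford–Tate menu of HM
(card dynkin-menu-intermediate-groups M2/M3), the degree-2 / threefold battleground of B
(Charles2013 Thm 1–2) and the abelian-pencil arrow Λ_F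
of B (card lefschetz-b-abelian-pencils-localisation) are deliberately NOT items: they are the first
lines of the two crux chains (birth
skeletons attached), to be registered by crux-plan seats; Δ decomposes in its own text (moving lemma
+ refined Gysin; tree partials
AlgebraicClassesCup, AmbientClassesMoving, AlgebraicClassesExteriorProduct,
SupportedClassesIrreducible).

CHEAPEST FALSIFIER. Run first: (1) `lean check` the consistency theorem HM ⟸ HC (the strategist's
`stub_hodgeClassesMotivated_of_hodgeConjecture`, no sorry) and the
BC5 special case B in the middle degree (bc/LefschetzStandardB_special.lean, PROVED) — both done, so
neither crux is "more false than HC" by a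
typing accident; (2) literature lookup: is any Hodge class known NOT to be absolute Hodge? (none as
of Voisin2025 §3.4 / CharlesSchnell2014Notes
§11.2 — a positive answer kills HM instantly); (3) the cheapest informative POSITIVE test: HM for S
× S, S a very general member of a complete
family of surfaces with big monodromy and p_g ≥ 2 (expected from Andre1996Motifs Thm 0.6.4 + Weyl
FFT: generic MT leaves no non-motivated
Hodge class) — a stub-worker-sized check; (4) for B: Charles2013 Thm 1 on one general-type threefold
with h^{2,0} = 1 (is there a deforming
rank-2 bundle whose φ_{c₂} hits H^{0,2}?).

NUMBERS. Deep middle: 2 ≤ p ≤ n/2, so the first dimension where HM has content is n = 4 (p = 2). B: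
open from dim Z = 3 on (degree-2 inverse Lefschetz
H⁴ → H² when h^{2,0}(Z) ≠ 0, κ(Z) = 3). Known-motivated-not-known-algebraic classes: Weil classes on
Weil-type abelian 2n-folds, n ≥ 3
(Andre1996Motifs Thm 0.6.2 vs Markman 2025 for n = 2, 3 with discriminant 1 only); Hodge classes on
K3 × K3 and powers of cubic fourfolds (Thm 0.6.3).

DEFINITION REQUESTS. - MotivatedGaloisGroup (topic Literature/AlgebraicGeometry/HodgeTheory): the
stabiliser in GL(H•(X(ℂ);ℚ)) of all motivated tensors on powers of X
  (André 1996 §4, reductive by Thm 0.4) on the real carriers — needed to type the π₀/Lie split of HM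
and card dynkin-menu-intermediate-groups; to be
  filed with `ledger workitem add --kind definition` once the route is open (not load-bearing for
`closes`).

Novelty: Searches (2026-08-17): `lean search 'StandardConjectureBStar|motivatedClasses … ≤ algebraicClasses|→
_root_.HodgeConjecture'` (272 hits: no landed HM→S / B→S theorem; found
the strategist LINE Cruxes/HodgeBeyondAnchors/Lines/andre_motivated_split.lean, 2026-08-17T01:12Z,
and its STRATEGY-CENSUS D1–D5); `lit search --hybrid "Lefschetz standard
conjecture … motivated cycles"` (12 docs; Voisin2025 §3.2 Conj. 3.11, Prop. 3.12, Cor. 3.16 READ pp.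
29–31); `lit read` Andre1996Motifs pp. 8–9, 23, 35 (Thm 0.5, 0.6.1–0.6.4,
7.1, footnote "B n'est autre … que le théorème 0.5"); `lit read arXiv:1002.5011` (Charles2013 Thm 1,
Prop. 8, Cor. 10 READ); `lit search --source arxiv "Lefschetz standard
conjecture"` (20: arXiv:2007.11872, arXiv:2304.00978, arXiv:2303.14327, arXiv:2512.04114,
arXiv:2011.06563, arXiv:math/0703005); `lit frontier HodgeConjecture --since 2021`
(arXiv:2603.22171 motivic exceptional locus, arXiv:2501.02315, arXiv:2606.08882); `lit galaxy search
"motivated cycles" --star all` (noise) and `--star pdf --mode bm25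
"motivic Galois group motivated cycles Hodge conjecture"` (Huber–Müller-Stach, Deligne–Milne 1982,
Ancona–Marmora); idea index: 4 open variant cards realised (listed in
front-matter); OpenAlex/S2 rate-limited (429) at 02:1xZ, logged.
Nearest prior art found: Andre1996Motifs §0.3 + Déf. 1 (the split itself, in one sentence, 1996);
in-tree: strategist line andre-motivated-split on stmt-HodgeConjecture-14054
(same three signatures, glue to the crux HodgeBeyondAnchor  [refs: 1002.5011, 2007.11872, 2304.00978, 2303.14327, 2512.04114, 2011.06563, math/0703005, 2603.22171, 2501.02315, 2606.08882, Voisin2025, Charles2013]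

Barriers (technique_class: motivated-cycles, standard-conjecture-B, tannakian): - technique_class: motivated-cycles, standard-conjecture-B, tannakian
- Literature.Barriers.HodgeConjecture.Andre1996_hodgeClassesOnAbelianVarieties_motivated: CONSISTENT
and proof-side — it is the abelian instance of this very split (HM a theorem there, B for compact
abelian pencils the residue); its refutation reading (an HC counterexample on an abelian variety
refutes B) is adopted verbatim as the kill criterion of LefschetzStandardB; its refuted universal
closure over abstract `BettiHodgeData` does not bite: every statement here is on the REAL carriers
(`complexBetti`, `IsOfHodgeType`).
- Literature.Barriers.HodgeConjecture.hodgeClassesAreAbsoluteFor_abelianVariety: consistent — HM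
refines the Charles–Schnell split Hodge ⊇ absolute Hodge ⊇ motivated ⊇ algebraic at the level where
the bottom inclusion costs ONE class per variety (B) instead of "absolute Hodge ⇒ algebraic"; no
Galois-conjugation argument is used proof-side; the barrier's scope (no conjugation refutation on
abelian varieties) only says HM's kill tests must be run OFF abelian type (card
hodge-endomorphism-census-pg2-surfaces), which is where they are aimed.
- Literature.Barriers.HodgeConjecture.Serre1964_conjugateVarieties_notHomeomorphic: not met —
motivated-ness is "de nature algébrique" (Andre1996Motifs §0.3 (i)); no transport of topology along
Aut(ℂ) occurs in HM, B, Δ or the glue.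
- Literature.Barriers.HodgeConjecture.CattaniDeligneKaplan1995_hodgeLocus_algebraicFor: not met
proof-side (used nowhere in `

History (route lifecycle, newest last):
- 2026-08-17T02:17:15Z · rev 1: restated Assembly (stmt-HodgeConjecture-17491) — cone repair (rrepair 2026-08-17): route imports re-cut to statement-level modules (MotivatedClasses, MiddleDimensionReduction, LefschetzOneOne, HodgeModelExiste (planner-rrepair-HodgeConjecture-MotivatedLefsc-6212bf6e-0)

sub-problem: HodgeConjecture · status: open · opened planner-plan-lens3-HodgeConjecture-decomp-0 2026-08-17T01:58:05Z · rev 2 · ledger route-HodgeConjecture-MotivatedLefschetzSplit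
GENERATED by the gate from the ledger (D-0016/17). Provers cite these decls: `theorem foo : Summit.HodgeConjecture.HodgeConjecture.Theses.MotivatedLefschetzSplit.<Decl> := …` in Summits/HodgeConjecture/HodgeConjecture/Theorems/<Name>.lean.
-/

namespace Summit.HodgeConjecture.HodgeConjecture.Theses.MotivatedLefschetzSplit

open scoped BigOperators Topology Manifold Classical MeasureTheory ProbabilityTheory Matrix InnerProductSpace ComplexConjugate ContinuousMap
open Filter Set Function TopologicalSpace MeasureTheory

attribute [summit_statement] _root_.HodgeConjecture

/-- item stmt-HodgeConjecture-17488 · crux · rank 2 · open · by planner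
why it might fail: a Hodge class that is not absolute Hodge (Deligne's conjecture false: e.g. an RM/CM endomorphism of H²_tr of a p_g ≥ 2 general-type surface moving under Aut(ℂ)) kills HM and HC at once; no lever off abelian type beyond Thm 0.5/0.6.4.
sources: Andre1996Motifs, Andre2006, Arapura2006, CharlesSchnell2014Notes, arXiv:2603.22171, arXiv:1702.05430
[crux] (HM, deep-middle form; verbatim the strategist's child on stmt-HodgeConjecture-14054) for X
smooth projective of dimension n over ℂ, 2 ≤ p, 2p ≤ n, every rational class of Hodge type (p,p) in
H²ᵖ(X(ℂ);ℂ) lies in `motivatedClasses n X p` (André Déf. 1 on the real carriers). Implied by HC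
(algebraic ⊆ motivated, tree theorem); a THEOREM for abelian varieties (Thm 0.6.2),
abelian-motivated varieties (K3, cubics ≤ dim 5, Fermat, products), monodromy-generic members (Thm
0.6.4 + Weyl); first open instances: Hodge endomorphisms of H²_tr(S) for surfaces S with p_g ≥ 2
(classes on S × S), exceptional (2,2)-classes at 0-dimensional Noether–Lefschetz components in ℙ⁵.
[difficulty: open-problem] -/
@[route_item "route-HodgeConjecture-MotivatedLefschetzSplit", crux]
def HodgeClassesMotivated : Prop :=
  ∀ ⦃n : ℕ⦄ ⦃X : Literature.AlgebraicGeometry.Motives.SchemeOver ℂ⦄, Literature.AlgebraicGeometry.Motives.IsSmoothProjective n X → ∀ p : ℕ, 2 ≤ p → 2 * p ≤ n → ∀ c : Literature.AlgebraicGeometry.HodgeTheory.complexBetti X (2 * p), Literature.AlgebraicGeometry.HodgeTheory.IsRationalClass c → Literature.AlgebraicGeometry.HodgeTheory.IsOfHodgeType n X (2 * p) p p c → c ∈ Literature.AlgebraicGeometry.HodgeTheory.motivatedClasses n X p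

/-- item stmt-HodgeConjecture-17489 · crux · rank 3 · open · by planner
why it might fail: false iff some inverse Lefschetz map is non-algebraic — first suspects: threefolds of general type with h^{2,0} ≠ 0 (degree-2 case, Charles2013 Thm 1 needs a codim-2 family whose infinitesimal invariant fills H^{0,2}) and very general Weil-type abelian-pencil total spaces.
sources: Kleiman1968AlgebraicCycles, Lieberman1968, Charles2013, CharlesMarkman2013, Arapura2006, Tankeev2011
[crux] (B; verbatim the strategist's child) Grothendieck's standard conjecture of Lefschetz type for
EVERY smooth projective complex Z, André's form: for every polarisation class η of Z (rational,
divisor-supported, hard Lefschetz) and all degrees a + b = 2 dim Z, the Lefschetz involution ⋆_L :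
Hᵃ(Z(ℂ)) → Hᵇ(Z(ℂ)) is induced by an algebraic class on Z × Z (`StandardConjectureBStar`). One
canonical absolute-Hodge class per variety; implied by HC(Z × Z) in print; known for curves,
surfaces, abelian varieties (Lieberman1968), flag varieties, complete intersections, uniruled
3-folds / unirational 4-folds / S^[n] (Arapura2006), 3-folds with κ < 3 (Tankeev2011), hyperkähler
of K3^[n] type (CharlesMarkman2013), Lagrangian-covered / fibred HK (Voisin2022, arXiv:2304.00978),
generalised Kummer type (arXiv:2303.14327); stable under products and for all polarisations at once
(Andre1996Motifs §3.2 Remarque). [difficulty: open-problem] -/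
@[route_item "route-HodgeConjecture-MotivatedLefschetzSplit", crux]
def LefschetzStandardB : Prop :=
  ∀ (d : ℕ) (Z : Literature.AlgebraicGeometry.Motives.SchemeOver ℂ) (η : Literature.AlgebraicGeometry.HodgeTheory.complexBetti Z 2), Literature.AlgebraicGeometry.Motives.IsSmoothProjective d Z → Literature.AlgebraicGeometry.HodgeTheory.StandardConjectureBStar d Z η

/-- item stmt-HodgeConjecture-17490 · support · rank 9 · closed · proved by Summit.HodgeConjecture.HodgeConjecture.Ring2.Hypotheses.diagonalPullback_mem_algebraicClasses_holds @ 6f1624bd37b4 (planner) · by planner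
sources: VoisinHodgeII2003, Andre1996Motifs
[support] (Δ; verbatim the strategist's support child) for V smooth projective complex and c ∈ Nᵖ
H²ᵖ((V × V)(ℂ); ℂ), the pull-back Δ^* c along the diagonal lies in Nᵖ H²ᵖ(V(ℂ); ℂ) — Voisin II Prop.
9.21 (i) with Chow's moving lemma (Lemma 9.22) and Fulton §19.1 purity; the single input the tree
isolates for "B ⇒ A_mot ⊆ A"
(`motivatedClasses_le_algebraicClasses_of_standardConjectureB_of_map_diagonal`, proved); it yields
the multiplicativity of algebraic classes (`cupProduct_mem_algebraicClasses_of_forall_map_diagonal`,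
proved). [difficulty: L] -/
@[route_item "route-HodgeConjecture-MotivatedLefschetzSplit", crux]
def DiagonalPullbackAlgebraic : Prop :=
  open CategoryTheory MonoidalCategory CartesianMonoidalCategory in ∀ ⦃d : ℕ⦄ ⦃V : Literature.AlgebraicGeometry.Motives.SchemeOver ℂ⦄, Literature.AlgebraicGeometry.Motives.IsSmoothProjective d V → ∀ (p : ℕ) ⦃c : Literature.AlgebraicGeometry.HodgeTheory.complexBetti (V ⊗ V) (2 * p)⦄, c ∈ Literature.AlgebraicGeometry.HodgeTheory.algebraicClasses (V ⊗ V) p → Literature.AlgebraicGeometry.HodgeTheory.complexBetti.map (lift (𝟙 V) (𝟙 V)) (2 * p) c ∈ Literature.AlgebraicGeometry.HodgeTheory.algebraicClasses V p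

/-- item stmt-HodgeConjecture-17934 · support · rank 9 · closed · proved by Summit.HodgeConjecture.HodgeConjecture.Theorems.motivatedLefschetzSplit_motivatedSubAlgebraic_proof @ 0cfcef9cf1e7 (prover) · by planner
sources: Andre1996Motifs, VoisinHodgeII2003
[support] (André 1996 §2.1, remark after Déf. 1, p. 14; §0.3) in route vocabulary: if the Lefschetz
involution of every polarised smooth projective complex variety is an algebraic correspondence (the
statement of `LefschetzStandardB`, inlined) and diagonal pull-back preserves the coniveau (the
statement of `DiagonalPullbackAlgebraic`, inlined), then A_motᵖ(X)_ℂ ⊆ Nᵖ H²ᵖ(X(ℂ); ℂ) =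
algebraicClasses X p for every smooth projective X and every p. PROVABLE NOW: the rev-0 glue proved
exactly this inline from tree theorems of
`Literature.AlgebraicGeometry.HodgeTheory.MotivatedClassesProofs`
(`cupProduct_mem_algebraicClasses_of_forall_map_diagonal`,
`corrClassAction_mem_algebraicClasses_of_cupProduct`,
`gysinMap_mem_supportedClasses_of_isSmoothProjective`, `cupProduct_mem_supportedClasses_congr`);
candidate proof attached as evidence (SupportCheck.lean, `motivatedSubAlgebraic_proof`, lean check
rc 0, 0 sorries). Filed as an item (instead of inlined) so that the route file imports
statement-level modules only (cone repair 2026-08-17). [difficulty: provable-now] -/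
@[route_item "route-HodgeConjecture-MotivatedLefschetzSplit", crux]
def MotivatedSubAlgebraic : Prop :=
  open CategoryTheory MonoidalCategory CartesianMonoidalCategory in (∀ (d : ℕ) (Z : Literature.AlgebraicGeometry.Motives.SchemeOver ℂ) (η : Literature.AlgebraicGeometry.HodgeTheory.complexBetti Z 2), Literature.AlgebraicGeometry.Motives.IsSmoothProjective d Z → Literature.AlgebraicGeometry.HodgeTheory.StandardConjectureBStar d Z η) → (∀ ⦃d : ℕ⦄ ⦃V : Literature.AlgebraicGeometry.Motives.SchemeOver ℂ⦄, Literature.AlgebraicGeometry.Motives.IsSmoothProjective d V → ∀ (p : ℕ) ⦃c : Literature.AlgebraicGeometry.HodgeTheory.complexBetti (V ⊗ V) (2 * p)⦄, c ∈ Literature.AlgebraicGeometry.HodgeTheory.algebraicClasses (V ⊗ V) p → Literature.AlgebraicGeometry.HodgeTheory.complexBetti.map (lift (𝟙 V) (𝟙 V)) (2 * p) c ∈ Literature.AlgebraicGeometry.HodgeTheory.algebraicClasses V p) → ∀ ⦃n : ℕ⦄ ⦃X : Literature.AlgebraicGeometry.Motives.SchemeOver ℂ⦄, Literature.AlgebraicGeometry.Motives.IsSmoothProjective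 n X → ∀ p : ℕ, Literature.AlgebraicGeometry.HodgeTheory.motivatedClasses n X p ≤ Literature.AlgebraicGeometry.HodgeTheory.algebraicClasses X p

/-- item stmt-HodgeConjecture-17935 · support · rank 9 · closed · proved by Summit.HodgeConjecture.HodgeConjecture.Theorems.motivatedLefschetzSplit_middleDimensionAndModels_proof @ 9f62871dda24 (prover) · by planner
sources: BrosnanFangNiePearlstein2009, VoisinHodgeI2002, SerreGAGA1956
[support] the two DISCHARGED named facts the glue consumes, by name: BFNP Lemma 48
`Literature.AlgebraicGeometry.HodgeTheory.middleDimensionReduction` (the Hodge conjecture for all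
(p, n) from rational (m,m)-classes on smooth projective 2m-folds; discharged by
`middleDimensionReduction_holds`, module MiddleDimensionReductionHolds) and the existence of Hodge
models `nonempty_hodgeModel n X` for every (n, X) (discharged by `nonempty_hodgeModel_holds`, module
ComplexConjugationHolds). PROVABLE NOW in one line: `⟨middleDimensionReduction_holds, fun _ _ ↦
nonempty_hodgeModel_holds⟩` (SupportCheck.lean, rc 0). Stated through the named-fact constants on
purpose: the discharge modules have 1000+-module import cones carrying unrelated unproved facts, so
they are imported by the proving Theorems file, not by the route file (cone repair 2026-08-17).
[difficulty: provable-now] -/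
@[route_item "route-HodgeConjecture-MotivatedLefschetzSplit", crux]
def MiddleDimensionAndModels : Prop :=
  Literature.AlgebraicGeometry.HodgeTheory.middleDimensionReduction ∧ ∀ (n : ℕ) (X : Literature.AlgebraicGeometry.Motives.SchemeOver ℂ), Literature.AlgebraicGeometry.HodgeTheory.nonempty_hodgeModel n X

/-- item stmt-HodgeConjecture-17936 · support · rank 9 · closed · proved by Summit.HodgeConjecture.HodgeConjecture.Theorems.motivatedLefschetzSplit_lefschetzOneOneRational_proof @ 9f62871dda24 (prover) · by planner
sources: VoisinHodgeI2002, VoisinHodgeII2003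
[support] Lefschetz's theorem on (1,1)-classes, rational form — the named fact
`Literature.AlgebraicGeometry.HodgeTheory.lefschetzOneOne_rational` (Voisin I Thm 11.30 + Lelong +
GAGA), DISCHARGED in the tree by `lefschetzOneOne_rational_holds` (module LefschetzOneOneHolds,
import cone 1516 modules — hence consumed as an item proved in a Theorems file rather than imported
by the route file). PROVABLE NOW in one line (SupportCheck.lean, rc 0). The glue uses it for the
middle degree m = 1 of surfaces. [difficulty: provable-now] -/
@[route_item "route-HodgeConjecture-MotivatedLefschetzSplit", crux]
def LefschetzOneOneRational : Prop :=
  Literature.AlgebraicGeometry.HodgeTheory.lefschetzOneOne_rational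

-- earlier Assembly (stmt-HodgeConjecture-17491, replaced 2026-08-17T02:17:15Z -> stmt-HodgeConjecture-17933): retired by None — HodgeClassesMotivated → LefschetzStandardB → DiagonalPullbackAlgebraic → _root_.HodgeConjecture
/-- item stmt-HodgeConjecture-17933 · assembly · rank 1 · closed · proved by Summit.HodgeConjecture.HodgeConjecture.Theorems.motivatedLefschetzSplit_assembly_proof @ 4b18f4f7cb48 (prover) · by planner
sources: Andre1996Motifs, BrosnanFangNiePearlstein2009
[assembly] HodgeClassesMotivated → LefschetzStandardB → DiagonalPullbackAlgebraic →
MotivatedSubAlgebraic → MiddleDimensionAndModels → LefschetzOneOneRational → HodgeConjecture (the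
deciding theorem `closes` has exactly this type; rev-1 cone repair: the three discharged Literature
theorems and André's §2.1 step are now support items). -/
@[route_item "route-HodgeConjecture-MotivatedLefschetzSplit"]
def Assembly : Prop :=
  HodgeClassesMotivated → LefschetzStandardB → DiagonalPullbackAlgebraic → MotivatedSubAlgebraic → MiddleDimensionAndModels → LefschetzOneOneRational → _root_.HodgeConjecture

/-! D-0027 §2.1 — DECIDING THEOREM (planner-authored via `route open/edit --closes-file`; by planner-rrepair-HodgeConjecture-MotivatedLefsc-6212bf6e-0 2026-08-17T02:17:15Z):
its hypotheses are this route's items and its conclusion the sub-problem Statement (glue_lint), and it elaborates with this file. -/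

/-- The deciding theorem, re-cut for the cone repair: the two cruxes (HM, B), the support Δ, André's
§2.1 step (support, provable now from `MotivatedClassesProofs`), BFNP Lemma 48 + Hodge models and
Lefschetz (1,1) (supports = discharged named facts) close the summit. -/
@[closes "route-HodgeConjecture-MotivatedLefschetzSplit"] theorem closes (hM : HodgeClassesMotivated) (hB : LefschetzStandardB) (hΔ : DiagonalPullbackAlgebraic)
    (hA : MotivatedSubAlgebraic) (hR : MiddleDimensionAndModels) (h11 : LefschetzOneOneRational) :
    _root_.HodgeConjecture := by
  intro n X hX
  refine Literature.AlgebraicGeometry.HodgeTheory.hodgeConjectureFor_of_middleDimension hR.1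
    (fun k Y hY ↦ Literature.AlgebraicGeometry.HodgeTheory.nonempty_hodgeModel.nonempty (hR.2 k Y) hY)
    (fun m Y hY c hc hpp ↦ ?_) hX
  rcases Nat.lt_or_ge m 2 with hm | hm
  · interval_cases m
    · rw [Literature.AlgebraicGeometry.HodgeTheory.algebraicClasses_zero]; exact Submodule.mem_top
    · exact h11 hY c hc hpp
  · exact hA hB hΔ hY m (hM hY m hm le_rfl c hc hpp)

end Summit.HodgeConjecture.HodgeConjecture.Theses.MotivatedLefschetzSplit
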